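import Mathlib.CategoryTheory.Limits.Preserves.Shapes.Pullbacks
import Literature.AnabelianGeometry.SemiGraphs.PullbackFunctor
import Literature.AnabelianGeometry.SemiGraphs.BObjReglue

/-!
# The section pull-back of an object over `A` along a covering, and its blindness to regluing
# ([SemiAnbd] §2, Def. 2.2 (i) p. 23, Cor. 2.7 (i) p. 30)

Mochizuki, *Semi-graphs of anabelioids*, Publ. RIMS **42** (2006) 221–322, §2: for the finite étale
covering `φ : 𝒢′ → 𝒢` attached to `A ∈ B(𝒢)`, "`B′ = B(𝒢)_{G′}`" (Def. 2.2 (i), p. 23) — an object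
`B → A` over `A` becomes an object of `B(𝒢′)` — and the proof of Cor. 2.7 (i) (p. 30) reads objects of
`B(𝒢′)` sheet by sheet [cite: MochizukiSemiAnbd2006, Def. 2.2(i) p.23].

abc-iut cell, layer L3, FACT-LIST row F-1487 (`covering_subgraphComponents_doubleCosets` AS TYPED), seat
abc-iut-w4-d080 — bricks (R2)/(R3a) of the tree-free «regluing invisibility» route
(`HOME/staging/w4/w4-d080-g7/F1487-MASSBALANCE-MEMO.md` §5).  For ANY morphism `φ : 𝒢′ → 𝒢`, any
`s : T ⟶ φ^* A` (in the application: the tautological section of the global clause, `T` terminal) and any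
`g : B ⟶ A`:

* `Hom.pullbackTwist`, `Hom.pullbackFunctor_obj_reglue_ψ` — pulling back a REGLUED object
  (`BObj.reglue`, abc-iut-w4-d080 (R1)) reglues the pull-back: `(φ^*(B^θ)).ψ_{b′} = (φ^*B).ψ_{b′} ≫ θ^φ_{b′}`
  with `θ^φ_{b′} = φ_{e′}^*(θ_{φ b′})` (re-indexed along `e(φ b′) = φ e(b′)`);
* `Hom.sectionPullback φ s g ∈ B(𝒢′)` — the CELLWISE pull-back of `φ^* g : φ^*B → φ^*A` along `s`:
  vertex objects `φ_{v′}^*B_u ×_{φ_{v′}^*A_u} T_{v′}`, edge objects likewise, glued by the exact branch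
  functors of `𝒢′` (which preserve pullbacks) and the gluings of `φ^*B`, `T`, `φ^*A`;
* `Hom.sectionPullback_reglue` — **blindness**: if every pulled-back twist `θ^φ_{b′}` restricts to the
  identity on the edge cell of the section pull-back (`fst ≫ θ^φ_{b′} = fst`), then the section pull-backs
  of `g` and of its descent `g : B^θ → A` to the reglued object are EQUAL (same cells, same gluings).

In the application (memo §5, bricks (R3b)/(R4)): the section `s_{e′}` factors through the component
`O_E(e′) ⊆ A_e` (`TieLabels`), a twist supported over another component `Q* ≠ O_E(e′)` of `A_e` satisfies the
hypothesis, and `α(B → A) ≅ sectionPullback` for the global equivalence `α : B(𝒢)_{/A} ⥲ B(𝒢′)`; so an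
edge-cell of `A` that is not a section label is invisible to `B(𝒢′)`.  Definitions + bookkeeping; no fact
is asserted; nothing here takes a side on [IUTchIII] Cor. 3.12.
-/

namespace Literature.AnabelianGeometry.SemiGraphs

open CategoryTheory CategoryTheory.Limits

universe v₁ u₁ u

namespace SemiGraphOfAnabelioids

namespace Hom

variable {𝒢' 𝒢 : SemiGraphOfAnabelioids.{v₁, u₁, u}} (φ : Hom 𝒢' 𝒢)

/-! ### Pulling back a reglued object -/

/-- The twist family of `φ^*(B^θ)` at a branch `b′` of `𝒢′` (abutting to `v′`): the automorphism
`(φ^*B).ψ_{b′}⁻¹ ≫ (φ^*(B^θ)).ψ_{b′}` of the edge object `(φ^*B)_{e′} = (φ^*(B^θ))_{e′}` — explicitly,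
`φ_{e′}^*(θ_{φ b′})` re-indexed along `e(φ b′) = φ e(b′)` (the vertex and edge objects of `φ^*(B^θ)` and
`φ^*B` coincide, only the gluings differ). [cite: MochizukiSemiAnbd2006, Rem. 2.11.1 p.32] -/
noncomputable def pullbackTwist (B : 𝒢.BObj)
    (θ : ∀ b : 𝒢.graph.Branch, B.T (𝒢.graph.edgeOf b) ≅ B.T (𝒢.graph.edgeOf b))
    (b' : 𝒢'.graph.Branch) (v' : 𝒢'.graph.Vertex) (h' : 𝒢'.graph.abuts b' = some v') :
    (φ.pullbackFunctor.obj B).T (𝒢'.graph.edgeOf b') ≅ (φ.pullbackFunctor.obj B).T (𝒢'.graph.edgeOf b') :=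
  ((φ.pullbackFunctor.obj B).ψ b' v' h').symm ≪≫ (φ.pullbackFunctor.obj (B.reglue θ)).ψ b' v' h'

/-- **Pull-back of a reglued object.**  The gluing of `φ^*(B^θ)` along `b′` is the gluing of `φ^*B`
along `b′` followed by the pulled-back twist: `(φ^*(B^θ)).ψ_{b′} = (φ^*B).ψ_{b′} ≫ θ^φ_{b′}`, i.e.
`φ^*(B^θ)` is `φ^*B` reglued. [cite: MochizukiSemiAnbd2006, Rem. 2.11.1 p.32] -/
theorem pullbackFunctor_obj_reglue_ψ (B : 𝒢.BObj)
    (θ : ∀ b : 𝒢.graph.Branch, B.T (𝒢.graph.edgeOf b) ≅ B.T (𝒢.graph.edgeOf b))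
    (b' : 𝒢'.graph.Branch) (v' : 𝒢'.graph.Vertex) (h' : 𝒢'.graph.abuts b' = some v') :
    (φ.pullbackFunctor.obj (B.reglue θ)).ψ b' v' h' =
      (φ.pullbackFunctor.obj B).ψ b' v' h' ≪≫ φ.pullbackTwist B θ b' v' h' := by
  rw [pullbackTwist, Iso.self_symm_id_assoc]

/-- The pulled-back twist in terms of the data: `(φ^*B).ψ_{b′} ≫ θ^φ_{b′} = φ_{b′} ≫ φ_{e′}^*(ψ_{φ b′} ≫ θ_{φ b′})`
(re-indexed), i.e. `θ^φ_{b′}` is `φ_{e′}^*(θ_{φ b′})` transported along the gluing.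
[cite: MochizukiSemiAnbd2006, Rem. 2.11.1 p.32] -/
theorem ψ_hom_comp_pullbackTwist_hom (B : 𝒢.BObj)
    (θ : ∀ b : 𝒢.graph.Branch, B.T (𝒢.graph.edgeOf b) ≅ B.T (𝒢.graph.edgeOf b))
    (b' : 𝒢'.graph.Branch) (v' : 𝒢'.graph.Vertex) (h' : 𝒢'.graph.abuts b' = some v') :
    ((φ.pullbackFunctor.obj B).ψ b' v' h').hom ≫ (φ.pullbackTwist B θ b' v' h').hom =
      (φ.φB b' v' h').hom.app (B.S (φ.base.vertexMap v')) ≫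
        (φ.φE (𝒢'.graph.edgeOf b') (𝒢.graph.edgeOf (φ.base.branchMap b'))
            (φ.base.edgeOf_branchMap b').symm).pullback.map
          ((B.ψ (φ.base.branchMap b') (φ.base.vertexMap v') (φ.base.abuts_branchMap b' v' h')).hom ≫
            (θ (φ.base.branchMap b')).hom) ≫
        (φ.reindexIso (𝒢'.graph.edgeOf b') _ _ (φ.base.edgeOf_branchMap b').symm rfl).hom.app B := by
  rw [pullbackTwist, Iso.trans_hom, Iso.symm_hom, Iso.hom_inv_id_assoc]
  change ((φ.gluingIso b' v' h').app (B.reglue θ)).hom = _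
  simp only [gluingIso, reindexIso, ψNatIso, Iso.trans_hom, Iso.app_hom, NatTrans.comp_app,
    Functor.isoWhiskerLeft_hom, Functor.whiskerLeft_app, Functor.isoWhiskerRight_hom,
    Functor.whiskerRight_app, NatIso.ofComponents_hom_app, eqToIso.hom, eqToHom_app,
    BObj.reglue_ψ_hom]
  rfl

/-! ### The cellwise pull-back along a section -/

section SectionPullback

variable {A : 𝒢.BObj} {T : 𝒢'.BObj} (s : T ⟶ φ.pullbackFunctor.obj A) {B : 𝒢.BObj} (g : B ⟶ A)

/-- The vertex leg `φ_{v′}^*(g_u) : (φ^*B)_{v′} → (φ^*A)_{v′}`. [cite: MochizukiSemiAnbd2006, Def. 2.2(i) p.23] -/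
noncomputable abbrev spLegS (v' : 𝒢'.graph.Vertex) :
    (φ.pullbackFunctor.obj B).S v' ⟶ (φ.pullbackFunctor.obj A).S v' :=
  (φ.pullbackFunctor.map g).fS v'

/-- The edge leg `φ_{e′}^*(g_e) : (φ^*B)_{e′} → (φ^*A)_{e′}`. [cite: MochizukiSemiAnbd2006, Def. 2.2(i) p.23] -/
noncomputable abbrev spLegT (e' : 𝒢'.graph.Edge) :
    (φ.pullbackFunctor.obj B).T e' ⟶ (φ.pullbackFunctor.obj A).T e' :=
  (φ.pullbackFunctor.map g).fT e'

/-- **The section pull-back** of `g : B → A` along `s : T → φ^*A`: the object of `B(𝒢′)` with vertex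
objects `(φ^*B)_{v′} ×_{(φ^*A)_{v′}} T_{v′}`, edge objects `(φ^*B)_{e′} ×_{(φ^*A)_{e′}} T_{e′}`, glued along
`b′` by `b′^*(pullback) ≅ pullback(b′^* cospan) ≅ pullback(edge cospan)` (exactness of `b′^*`, then
`pullback.map` along the gluings of `φ^*B`, `T`, `φ^*A` — an isomorphism of cospans by `BObj.Hom.comm`).  In the application `T` is terminal and `s` the tautological section, and this is the
object `α(B → A)` of "`B(𝒢)_{/A} = B(𝒢′)`". [cite: MochizukiSemiAnbd2006, Def. 2.2(i) p.23] -/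
noncomputable def sectionPullback : 𝒢'.BObj where
  S v' := pullback (φ.spLegS g v') (s.fS v')
  T e' := pullback (φ.spLegT g e') (s.fT e')
  ψ b' v' h' :=
    haveI : PreservesFiniteLimits (𝒢'.pull b' v' h').pullback := (𝒢'.pull b' v' h').property.1
    PreservesPullback.iso (𝒢'.pull b' v' h').pullback (φ.spLegS g v') (s.fS v') ≪≫
      asIso (pullback.map _ _ _ _ ((φ.pullbackFunctor.obj B).ψ b' v' h').hom (T.ψ b' v' h').hom
        ((φ.pullbackFunctor.obj A).ψ b' v' h').hom ((φ.pullbackFunctor.map g).comm b' v' h')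
        (s.comm b' v' h'))

/-- The gluing of the section pull-back followed by the first projection.
[cite: MochizukiSemiAnbd2006, Def. 2.1 p.23] -/
theorem sectionPullback_ψ_hom_fst (b' : 𝒢'.graph.Branch) (v' : 𝒢'.graph.Vertex)
    (h' : 𝒢'.graph.abuts b' = some v') :
    ((φ.sectionPullback s g).ψ b' v' h').hom ≫ pullback.fst _ _ =
      (𝒢'.pull b' v' h').pullback.map (pullback.fst _ _) ≫ ((φ.pullbackFunctor.obj B).ψ b' v' h').hom := by
  haveI : PreservesFiniteLimits (𝒢'.pull b' v' h').pullback := (𝒢'.pull b' v' h').property.1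
  change (PreservesPullback.iso (𝒢'.pull b' v' h').pullback (φ.spLegS g v') (s.fS v') ≪≫
      asIso (pullback.map _ _ _ _ ((φ.pullbackFunctor.obj B).ψ b' v' h').hom (T.ψ b' v' h').hom
        ((φ.pullbackFunctor.obj A).ψ b' v' h').hom ((φ.pullbackFunctor.map g).comm b' v' h')
        (s.comm b' v' h'))).hom ≫ pullback.fst _ _ = _
  rw [Iso.trans_hom, asIso_hom, Category.assoc, pullback.lift_fst, PreservesPullback.iso_hom_fst_assoc]

/-- The gluing of the section pull-back followed by the second projection.
[cite: MochizukiSemiAnbd2006, Def. 2.1 p.23] -/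
theorem sectionPullback_ψ_hom_snd (b' : 𝒢'.graph.Branch) (v' : 𝒢'.graph.Vertex)
    (h' : 𝒢'.graph.abuts b' = some v') :
    ((φ.sectionPullback s g).ψ b' v' h').hom ≫ pullback.snd _ _ =
      (𝒢'.pull b' v' h').pullback.map (pullback.snd _ _) ≫ (T.ψ b' v' h').hom := by
  haveI : PreservesFiniteLimits (𝒢'.pull b' v' h').pullback := (𝒢'.pull b' v' h').property.1
  change (PreservesPullback.iso (𝒢'.pull b' v' h').pullback (φ.spLegS g v') (s.fS v') ≪≫
      asIso (pullback.map _ _ _ _ ((φ.pullbackFunctor.obj B).ψ b' v' h').hom (T.ψ b' v' h').hom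
        ((φ.pullbackFunctor.obj A).ψ b' v' h').hom ((φ.pullbackFunctor.map g).comm b' v' h')
        (s.comm b' v' h'))).hom ≫ pullback.snd _ _ = _
  rw [Iso.trans_hom, asIso_hom, Category.assoc, pullback.lift_snd, PreservesPullback.iso_hom_snd_assoc]

/-- The first projection `sectionPullback → φ^*B` is a morphism of `B(𝒢′)`.
[cite: MochizukiSemiAnbd2006, Def. 2.1 p.23] -/
noncomputable def sectionPullbackFst : φ.sectionPullback s g ⟶ φ.pullbackFunctor.obj B where
  fS v' := pullback.fst _ _
  fT e' := pullback.fst _ _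
  comm b' v' h' := by
    rw [sectionPullback_ψ_hom_fst]
    rfl

/-- The second projection `sectionPullback → T` is a morphism of `B(𝒢′)`.
[cite: MochizukiSemiAnbd2006, Def. 2.1 p.23] -/
noncomputable def sectionPullbackSnd : φ.sectionPullback s g ⟶ T where
  fS v' := pullback.snd _ _
  fT e' := pullback.snd _ _
  comm b' v' h' := by
    rw [sectionPullback_ψ_hom_snd]
    rfl

/-- The square `sectionPullback → φ^*B → φ^*A` = `sectionPullback → T → φ^*A` commutes.
[cite: MochizukiSemiAnbd2006, Def. 2.1 p.23] -/
theorem sectionPullback_condition :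
    φ.sectionPullbackFst s g ≫ φ.pullbackFunctor.map g = φ.sectionPullbackSnd s g ≫ s := by
  apply BObj.hom_ext
  · funext v'
    exact pullback.condition
  · funext e'
    exact pullback.condition

end SectionPullback

/-! ### Blindness of the section pull-back to invisible twists -/

section Blind

variable {A : 𝒢.BObj} {T : 𝒢'.BObj} (s : T ⟶ φ.pullbackFunctor.obj A) {B : 𝒢.BObj} (g : B ⟶ A)
  (θ : ∀ b : 𝒢.graph.Branch, B.T (𝒢.graph.edgeOf b) ≅ B.T (𝒢.graph.edgeOf b))
  (hθ : ∀ b : 𝒢.graph.Branch, (θ b).hom ≫ g.fT (𝒢.graph.edgeOf b) = g.fT (𝒢.graph.edgeOf b))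

/-- The gluings of the section pull-backs of `g : B → A` and of its descent `B^θ → A` COINCIDE as soon
as every pulled-back twist is the identity on the edge cells of the section pull-back.
[cite: MochizukiSemiAnbd2006, Cor. 2.7(i) p.30] -/
theorem sectionPullback_reglue_ψ_hom
    (hinv : ∀ (b' : 𝒢'.graph.Branch) (v' : 𝒢'.graph.Vertex) (h' : 𝒢'.graph.abuts b' = some v'),
      pullback.fst (φ.spLegT g (𝒢'.graph.edgeOf b')) (s.fT (𝒢'.graph.edgeOf b')) ≫
          (φ.pullbackTwist B θ b' v' h').hom =
        pullback.fst (φ.spLegT g (𝒢'.graph.edgeOf b')) (s.fT (𝒢'.graph.edgeOf b')))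
    (b' : 𝒢'.graph.Branch) (v' : 𝒢'.graph.Vertex) (h' : 𝒢'.graph.abuts b' = some v') :
    ((φ.sectionPullback s (BObj.Hom.reglue g θ hθ)).ψ b' v' h').hom =
      ((φ.sectionPullback s g).ψ b' v' h').hom := by
  -- both are morphisms into the (same) edge pullback: compare the two projections
  have h1 := φ.sectionPullback_ψ_hom_fst s (BObj.Hom.reglue g θ hθ) b' v' h'
  have h2 := φ.sectionPullback_ψ_hom_fst s g b' v' h'
  have h3 := φ.sectionPullback_ψ_hom_snd s (BObj.Hom.reglue g θ hθ) b' v' h'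
  have h4 := φ.sectionPullback_ψ_hom_snd s g b' v' h'
  rw [pullbackFunctor_obj_reglue_ψ, Iso.trans_hom] at h1
  -- the first projection: `ψ₁ ≫ fst = L(fst) ≫ ψ_B ≫ θ^φ = (ψ₂ ≫ fst) ≫ θ^φ = ψ₂ ≫ fst`
  have h1' : ((φ.sectionPullback s (BObj.Hom.reglue g θ hθ)).ψ b' v' h').hom ≫ pullback.fst _ _ =
      ((φ.sectionPullback s g).ψ b' v' h').hom ≫
        pullback.fst (φ.spLegT g (𝒢'.graph.edgeOf b')) (s.fT (𝒢'.graph.edgeOf b')) :=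
    h1.trans <|
      ((Category.assoc _ _ _).symm.trans
          (congrArg (· ≫ (φ.pullbackTwist B θ b' v' h').hom) h2.symm)).trans
        ((Category.assoc _ _ _).trans
          (congrArg (((φ.sectionPullback s g).ψ b' v' h').hom ≫ ·) (hinv b' v' h')))
  have h3' : ((φ.sectionPullback s (BObj.Hom.reglue g θ hθ)).ψ b' v' h').hom ≫ pullback.snd _ _ =
      ((φ.sectionPullback s g).ψ b' v' h').hom ≫
        pullback.snd (φ.spLegT g (𝒢'.graph.edgeOf b')) (s.fT (𝒢'.graph.edgeOf b')) :=
    h3.trans h4.symm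
  exact pullback.hom_ext h1' h3'

/-- **Blindness.**  Under the hypothesis of `sectionPullback_reglue_ψ_hom`, the section pull-back of
the descent `B^θ → A` of `g` IS (literally, as a system `{S, T, ψ}`) the section pull-back of `g : B → A`.
[cite: MochizukiSemiAnbd2006, Cor. 2.7(i) p.30] -/
theorem sectionPullback_reglue
    (hinv : ∀ (b' : 𝒢'.graph.Branch) (v' : 𝒢'.graph.Vertex) (h' : 𝒢'.graph.abuts b' = some v'),
      pullback.fst (φ.spLegT g (𝒢'.graph.edgeOf b')) (s.fT (𝒢'.graph.edgeOf b')) ≫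
          (φ.pullbackTwist B θ b' v' h').hom =
        pullback.fst (φ.spLegT g (𝒢'.graph.edgeOf b')) (s.fT (𝒢'.graph.edgeOf b'))) :
    φ.sectionPullback s (BObj.Hom.reglue g θ hθ) = φ.sectionPullback s g := by
  change BObj.mk (fun v' => pullback (φ.spLegS g v') (s.fS v'))
      (fun e' => pullback (φ.spLegT g e') (s.fT e')) _ = BObj.mk _ _ _
  congr 1
  funext b' v' h'
  exact Iso.ext (φ.sectionPullback_reglue_ψ_hom s g θ hθ hinv b' v' h')

end Blind

end Hom

end SemiGraphOfAnabelioids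

end Literature.AnabelianGeometry.SemiGraphs
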